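import Literature.Computability.Complexity.AdaptiveFunctions
import Literature.Computability.Complexity.FoldBricks
import Literature.Computability.Complexity.BPPErrorReductionStrong
import Literature.Computability.Complexity.BPClosureProofs
import Literature.Computability.Complexity.UniformProbBlocks
import Literature.Computability.Complexity.BPExpOperator
import Literature.Computability.Complexity.ProbabilisticClassesProofs
import Literature.Computability.Complexity.RandomizedProofs
import HarnessLib

/-!
# Adaptive oracle transducers against a `BPP` oracle are pseudo-deterministic `BPP` computations

Topic `Computability/Complexity` (probabilistic classes; oracle computation). The bounded adaptive
oracle transducers of `AdaptiveQueries.lean` / `AdaptiveFunctions.lean` — `q(|x|)` one-bit queries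
`Qg ⟨x, answers so far⟩`, then an output `G ⟨x, answers⟩` (`AdQuery.adBits`, `AdQuery.adFn`,
`AdQuery.adLang`) — are the tree's normal form of polynomial-time Turing reductions. This file
proves the textbook fact that such a reduction TO A `BPP` LANGUAGE `A` is itself a bounded-error
probabilistic polynomial-time computation, in the strong "pseudo-deterministic" form: one
randomized polynomial-time algorithm reproduces the whole answer string `adBits Qg A x (q|x|)` —
hence the deterministic value `adFn Qg q G A x` — with probability `≥ 3/4` on EVERY input
(Arora–Barak 2009, §7.4.1 with Thm. 7.10: reduce the error of the `BPP` algorithm for `A` so far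
that, by the union bound over all polynomially many / polynomially long queries, a single random
string answers every query correctly; "`BPP^{BPP} = BPP`", Ko 1982; Zachos 1988).

Construction (`AdBPPSim`): let `B ∈ P` with coin polynomial `t` decide the padded language
`{⟨s, 1⟩ | s ∈ A}` with error `≤ 2^{-|⟨s,1⟩|} = 2^{-(2|s|+3)}` (`BPP_subset_bpErr_two_pow`, the tree's
Thm. 7.10). With ONE coin string `r` answer the query `s` by `[⟨⟨s, 1⟩, r ↾ t(2|s|+3)⟩ ∈ B]`
(`coinLang B t r`); the answer string so obtained is `accF … ⟨x, r⟩ = adBits Qg (coinLang B t r) x (q|x|)`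
(`accF_apply`), an `FP` function of `⟨x, r⟩` (`accF_mem_FP`: a counted fold, `FoldBricks.lean`).
A coin string is bad only if it errs on some string of length `≤ c(|x|)` (a bound on the queries),
and `Σ_{ℓ ≤ c} 2^ℓ · 2^{-(2ℓ+3)} ≤ 1/4` (`uniformProb_accF_ne_le`). Consequences:

* `exists_randAlg_adFn` — a PPT `RandAlg (List Bool) (List Bool)` with an exactly polynomial coin
  budget computing `adFn Qg q G A x` with probability `≥ 3/4` for every `x`;
* `exists_randAlg_adFn_unary` — the same on unary inputs `1ⁿ` (`RandAlg ℕ (List Bool)`, the shape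
  of the refuters of `MetaComplexity/ConstructiveSeparations.lean`);
* `adLang_mem_BPP` — **`adLang Qg q D A ∈ BPP`** for `Qg ∈ FP`, `D ∈ P`, `A ∈ BPP` (the decision
  form, `P^{BPP} = BPP` for bounded adaptive reductions), via `mem_BPP_iff_randAlg`.

## References

* S. Arora, B. Barak, *Computational Complexity: A Modern Approach*, CUP 2009, §7.4.1 (error
  reduction and the union bound), Thm. 7.10, §3.4 (oracle machines) [AroraBarak2009].
* K.-I Ko, *Some observations on the probabilistic algorithms and NP-hard problems*, IPL 14 (1982)
  (`BPP` is low for itself); S. Zachos, *Probabilistic quantifiers and games*, JCSS 36 (1988).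
* L. Chen, C. Jin, R. Santhanam, R. Williams, *Constructive separations and their consequences*,
  FOCS 2021, §5.1 (end of proof of Thm. 4: "by standard amplification … with `1 - 2^{-n}` probability
  `A'(·, r)` decides the same language as `A` on input length `n`") [ChenEtAl2022] — the consumer.
-/

noncomputable section

namespace Literature.Computability.Complexity

open _root_.Computability Polynomial Brick Plumb AdQuery Finset

namespace AdBPPSim

/-! ### The oracle simulated from a coin string -/

/-- The padded query `⟨s, 1⟩` (one extra symbol, so that the amplified error `2^{-|⟨s,1⟩|}` is
`2^{-(2|s|+3)}`, summable over all `s`). [folklore] -/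
def padQ : List Bool → List Bool := fanoutFn id (fun _ => [true])

/-- `padQ s = ⟨s, [1]⟩`. [folklore] -/
@[simp] theorem padQ_apply (s : List Bool) : padQ s = boolPair s [true] := by simp [padQ]

/-- `|padQ s| = 2|s| + 3`. [folklore] -/
@[simp] theorem length_padQ (s : List Bool) : (padQ s).length = 2 * s.length + 3 := by
  rw [padQ_apply, length_boolPair]; rfl

/-- `padQ ∈ FP`. [folklore] -/
theorem padQ_mem_FP : padQ ∈ FP := fanoutFn_mem_FP OracleCompose.id_mem_FP (const_mem_FP _)

variable (B : Language Bool) (t : Polynomial ℕ)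

/-- **The oracle simulated from the coin string `r`**: the query `s` is answered by the witness
language `B` on `⟨padQ s, r ↾ t(|padQ s|)⟩` — the amplified `BPP` algorithm run with (a prefix of)
the fixed coins `r`. ("`A'(·, r)`" of [ChenEtAl2022, §5.1].) [cite: AroraBarak2009, §7.4.1] -/
def coinLang (r : List Bool) : Language Bool := {s | boolPair (padQ s) (r.take (t.eval (padQ s).length)) ∈ B}

/-- Membership in `coinLang`. [folklore] -/
theorem mem_coinLang_iff (r s : List Bool) :
    s ∈ coinLang B t r ↔ boolPair (padQ s) (r.take (t.eval (padQ s).length)) ∈ B := Iff.rfl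

/-- Agreement of indicators from agreement of memberships (two sets, two points). [folklore] -/
theorem boolIndicator_congr' {X Y : Language Bool} {a b : List Bool} (h : a ∈ X ↔ b ∈ Y) :
    X.boolIndicator a = Y.boolIndicator b := by
  by_cases ha : a ∈ X
  · rw [(Set.mem_iff_boolIndicator _ _).1 ha, (Set.mem_iff_boolIndicator _ _).1 (h.1 ha)]
  · rw [(Set.notMem_iff_boolIndicator _ _).1 ha, (Set.notMem_iff_boolIndicator _ _).1 (fun h' => ha (h.2 h'))]

/-- `encodeBool b = [b]`. [folklore] -/
theorem encodeBool_eq (b : Bool) : encodeBool b = [b] := rfl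

/-! ### The simulated answer string as an `FP` function of `⟨x, r⟩` -/

variable (Qg : List Bool → List Bool) (q : Polynomial ℕ)

/-- The query of the current round, read off `⟨acc, ⟨x, r⟩⟩`: `Qg ⟨x, acc⟩`. [folklore] -/
def qpart : List Bool → List Bool := Qg ∘ fanoutFn (fstF ∘ sndF) fstF

/-- The coins handed to the query: `r ↾ t(|padQ (Qg ⟨x, acc⟩)|)`. [folklore] -/
def cpart : List Bool → List Bool := takeFn ∘ fanoutFn (polyFn t ∘ padQ ∘ qpart Qg) (sndF ∘ sndF)

/-- The answer bit of the current round (as a one-symbol string). [folklore] -/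
def bitF : List Bool → List Bool :=
  (fun w => encodeBool (B.boolIndicator w)) ∘ fanoutFn (padQ ∘ qpart Qg) (cpart t Qg)

/-- **The fold operation**: `⟨acc, ⟨x, r⟩⟩ ↦ acc ++ [answer bit]`. [folklore] -/
def opF : List Bool → List Bool := fun z => fstF z ++ bitF B t Qg z

/-- The initial loop record `⟨⟨x, r⟩, ⟨encodeNat (q|x|), ⟨1⁰, []⟩⟩⟩`. [folklore] -/
def initF : List Bool → List Bool :=
  fanoutFn id (fanoutFn (lenBinF ∘ polyFn q ∘ fstF) (fun _ => boolPair [] []))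

/-- **The simulated answer string** `accF ⟨x, r⟩`: `q(|x|)` rounds of the fold. [cite: AroraBarak2009, §7.4.1] -/
def accF : List Bool → List Bool := sndPow 2 ∘ foldLoop (opF B t Qg) fstF q ∘ initF q

variable {B t Qg q}

/-- Value of the fold operation on a record. [folklore] -/
theorem opF_apply (acc x r : List Bool) :
    opF B t Qg (boolPair acc (boolPair x r)) = acc ++ [(coinLang B t r).boolIndicator (Qg (boolPair x acc))] := by
  have hq : qpart Qg (boolPair acc (boolPair x r)) = Qg (boolPair x acc) := by
    simp [qpart]
  have hc : cpart t Qg (boolPair acc (boolPair x r)) = r.take (t.eval (padQ (Qg (boolPair x acc))).length) := by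
    simp only [cpart, Function.comp_apply, fanoutFn_apply, hq, sndF_boolPair, polyFn_apply, takeFn_boolPair,
      List.length_replicate]
  have hbit : bitF B t Qg (boolPair acc (boolPair x r)) =
      [B.boolIndicator (boolPair (padQ (Qg (boolPair x acc))) (r.take (t.eval (padQ (Qg (boolPair x acc))).length)))] := by
    simp only [bitF, Function.comp_apply, fanoutFn_apply, hq, hc, encodeBool_eq]
  rw [opF, fstF_boolPair, hbit, boolIndicator_congr' (mem_coinLang_iff B t r (Qg (boolPair x acc))).symm]

/-- The fold computes the adaptive answer bits against the simulated oracle. [folklore] -/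
theorem foldAcc_opF (x r : List Bool) (i : ℕ) : ∀ k : ℕ,
    foldAcc (opF B t Qg) fstF (boolPair x r) i k [] = adBits Qg (coinLang B t r) x k
  | 0 => rfl
  | k + 1 => by rw [foldAcc_succ', foldAcc_opF x r i k, fstF_boolPair, opF_apply, adBits_succ]

/-- **`accF ⟨x, r⟩` is the answer string against the simulated oracle.** [cite: AroraBarak2009, §7.4.1] -/
theorem accF_apply (x r : List Bool) :
    accF B t Qg q (boolPair x r) = adBits Qg (coinLang B t r) x (q.eval x.length) := by
  have hinit : initF q (boolPair x r) =
      boolPair (boolPair x r) (boolPair (encodeNat (q.eval x.length)) (boolPair (ones 0) [])) := by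
    simp [initF]
  have hk : q.eval x.length ≤ q.eval (boolPair x r).length :=
    TM2Iter.eval_mono q (by rw [length_boolPair]; omega)
  rw [accF, Function.comp_apply, Function.comp_apply, hinit, foldLoop_apply _ _ hk, foldAcc_opF]
  simp

/-- The fold operation has additive growth `1`. [folklore] -/
theorem length_opF_le (w : List Bool) : (opF B t Qg w).length ≤ (fstF w).length + (sndF w).length + 1 := by
  simp [opF, bitF, encodeBool]

/-- **`accF ∈ FP`** for `Qg ∈ FP` and `B ∈ P`. [cite: AroraBarak2009, §7.4.1 with §1.3] -/
theorem accF_mem_FP (hQ : Qg ∈ FP) (hB : B ∈ Classes.P) : accF B t Qg q ∈ FP := by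
  have hq : qpart Qg ∈ FP := comp_mem_FP hQ (fanoutFn_mem_FP (comp_mem_FP fstF_mem_FP sndF_mem_FP) fstF_mem_FP)
  have hc : cpart t Qg ∈ FP := comp_mem_FP takeFn_mem_FP
    (fanoutFn_mem_FP (comp_mem_FP (polyFn_mem_FP t) (comp_mem_FP padQ_mem_FP hq)) (comp_mem_FP sndF_mem_FP sndF_mem_FP))
  have hbit : bitF B t Qg ∈ FP :=
    comp_mem_FP (indicatorFn_mem_FP hB) (fanoutFn_mem_FP (comp_mem_FP padQ_mem_FP hq) hc)
  have hop : opF B t Qg ∈ FP := append_mem_FP fstF_mem_FP hbit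
  have hinit : initF q ∈ FP := fanoutFn_mem_FP OracleCompose.id_mem_FP
    (fanoutFn_mem_FP (comp_mem_FP lenBinF_mem_FP (comp_mem_FP (polyFn_mem_FP q) fstF_mem_FP)) (const_mem_FP _))
  exact comp_mem_FP (sndPow_mem_FP 2) (comp_mem_FP
    (foldLoop_mem_FP (C := 1) hop length_opF_le fstF_mem_FP (fun w => by omega) q) hinit)

/-! ### Good coin strings reproduce the true answer bits -/

/-- **Oracles that agree on all short strings give the same answer bits**, as long as the queries
are short. [folklore] -/
theorem adBits_congr_of_agree {X Y : Language Bool} {x : List Bool} {c n : ℕ}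
    (hlen : ∀ k < n, (Qg (boolPair x (adBits Qg Y x k))).length ≤ c)
    (hagree : ∀ s : List Bool, s.length ≤ c → (s ∈ X ↔ s ∈ Y)) :
    ∀ k ≤ n, adBits Qg X x k = adBits Qg Y x k
  | 0, _ => rfl
  | k + 1, hk => by
    rw [adBits_succ, adBits_succ, adBits_congr_of_agree hlen hagree k (by omega),
      boolIndicator_congr' (hagree _ (hlen k (by omega)))]

/-! ### The probability estimate -/

/-- `Σ_{j < n} (1/2)^j ≤ 2`. [folklore] -/
theorem sum_half_pow_le_two (n : ℕ) : ∑ j ∈ range n, (1 / 2 : ℝ) ^ j ≤ 2 := by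
  rw [geom_sum_eq (by norm_num) n]
  have h : (0 : ℝ) ≤ (1 / 2) ^ n := by positivity
  have : ((1 / 2 : ℝ) ^ n - 1) / (1 / 2 - 1) = 2 * (1 - (1 / 2) ^ n) := by ring
  rw [this]; nlinarith

/-- **The union bound.** Let `B ∈ P`, `t` decide the padded language `{⟨s,1⟩ | s ∈ A}` with error
`≤ 2^{-|w|}` on every `w`, let all queries on `x` (against `A`) have length `≤ c`, and let
`T ≥ t(2c + 3)`. Then the coin strings of length `T` on which the simulated answer string differs
from the true one have probability `≤ 1/4`: such a string errs on some `s` with `|s| ≤ c`, an event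
of probability `≤ 2^{-(2|s|+3)}` (prefix coins), and `Σ_{ℓ ≤ c} 2^ℓ 2^{-(2ℓ+3)} ≤ 1/4`.
[cite: AroraBarak2009, §7.4.1 (union bound)] -/
theorem uniformProb_accF_ne_le {A : Language Bool} {x : List Bool} {c T : ℕ}
    (hB : ∀ w : List Bool, uniformProb (t.eval w.length) {y | ¬ (boolPair w y ∈ B ↔ fstF w ∈ A)} ≤ 1 / 2 ^ w.length)
    (hlen : ∀ k < q.eval x.length, (Qg (boolPair x (adBits Qg A x k))).length ≤ c)
    (hT : t.eval (2 * c + 3) ≤ T) :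
    uniformProb T {r | accF B t Qg q (boolPair x r) ≠ adBits Qg A x (q.eval x.length)} ≤ 1 / 4 := by
  -- the bad event of one string `s`
  set Bad : List Bool → Set (List Bool) := fun s => {r | ¬ (s ∈ coinLang B t r ↔ s ∈ A)} with hBad
  have hBadP : ∀ s : List Bool, s.length ≤ c → uniformProb T (Bad s) ≤ (1 / 2 : ℝ) ^ (2 * s.length + 3) := by
    intro s hs
    have hts : t.eval (padQ s).length ≤ T := by
      rw [length_padQ]; exact (TM2Iter.eval_mono t (by omega)).trans hT
    obtain ⟨d, hd⟩ : ∃ d, T = t.eval (padQ s).length + d := ⟨T - t.eval (padQ s).length, by omega⟩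
    have hE : uniformProb (t.eval (padQ s).length) {y | ¬ (boolPair (padQ s) y ∈ B ↔ s ∈ A)} ≤ (1 / 2 : ℝ) ^ (2 * s.length + 3) := by
      have h := hB (padQ s)
      rw [show fstF (padQ s) = s by simp, length_padQ, one_div, ← inv_pow] at h
      simpa [one_div] using h
    rw [hd]
    exact BPExp.uniformProb_take_le {y | ¬ (boolPair (padQ s) y ∈ B ↔ s ∈ A)} hE
  -- a coin string outside all bad events reproduces the true answer bits
  have hsub : ∀ r ∈ {r : List Bool | accF B t Qg q (boolPair x r) ≠ adBits Qg A x (q.eval x.length)}, r.length = T →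
      r ∈ ⋃ j ∈ range (c + 1), ⋃ v ∈ (univ : Finset (List.Vector Bool j)), Bad v.toList := by
    intro r hne _
    by_contra hgood
    simp only [Set.mem_iUnion, mem_range, Finset.mem_univ, exists_true_left, not_exists] at hgood
    apply hne
    rw [accF_apply]
    refine adBits_congr_of_agree (X := coinLang B t r) (Y := A) hlen (fun s hs => ?_) _ le_rfl
    have h := hgood s.length (by omega) ⟨s, rfl⟩
    simpa [hBad] using h
  calc uniformProb T {r | accF B t Qg q (boolPair x r) ≠ adBits Qg A x (q.eval x.length)}
      ≤ uniformProb T (⋃ j ∈ range (c + 1), ⋃ v ∈ (univ : Finset (List.Vector Bool j)), Bad v.toList) :=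
        BPExp.uniformProb_mono_len hsub
    _ ≤ ∑ j ∈ range (c + 1), uniformProb T (⋃ v ∈ (univ : Finset (List.Vector Bool j)), Bad v.toList) :=
        uniformProb_biUnion_le _ _ _
    _ ≤ ∑ j ∈ range (c + 1), ∑ v ∈ (univ : Finset (List.Vector Bool j)), uniformProb T (Bad v.toList) :=
        sum_le_sum fun j _ => uniformProb_biUnion_le _ _ _
    _ ≤ ∑ j ∈ range (c + 1), ∑ v ∈ (univ : Finset (List.Vector Bool j)), (1 / 2 : ℝ) ^ (2 * j + 3) :=
        sum_le_sum fun j hj => sum_le_sum fun v _ => by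
          have := hBadP v.toList (by rw [List.Vector.toList_length]; exact Nat.lt_succ_iff.1 (mem_range.1 hj))
          rwa [List.Vector.toList_length] at this
    _ = ∑ j ∈ range (c + 1), (1 / 8 : ℝ) * (1 / 2) ^ j := by
        refine sum_congr rfl fun j _ => ?_
        rw [sum_const, card_univ, card_vector, Fintype.card_bool, nsmul_eq_mul]
        push_cast
        rw [show 2 * j + 3 = j + (j + 3) by ring, pow_add, ← mul_assoc, ← mul_pow, pow_add]
        norm_num
        rw [mul_comm]
    _ = (1 / 8 : ℝ) * ∑ j ∈ range (c + 1), (1 / 2 : ℝ) ^ j := by rw [mul_sum]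
    _ ≤ (1 / 8 : ℝ) * 2 := by gcongr; exact sum_half_pow_le_two _
    _ = 1 / 4 := by norm_num

/-- **The main estimate.** For `A ∈ BPP` and `Qg ∈ FP` there are a witness language `B ∈ P`, a coin
polynomial `t` and a coin budget `T` such that, for every `x`, the simulated answer string
`accF B t Qg q ⟨x, r⟩` equals `adBits Qg A x (q|x|)` for at least `3/4` of the coin strings `r` of
length `T(|x|)`. [cite: AroraBarak2009, §7.4.1 with Thm. 7.10] -/
theorem exists_accF_good {A : Language Bool} (hA : A ∈ BPP) {Qg : List Bool → List Bool} (hQ : Qg ∈ FP)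
    (q : Polynomial ℕ) :
    ∃ B ∈ Classes.P, ∃ t T : Polynomial ℕ, ∀ x : List Bool,
      3 / 4 ≤ uniformProb (T.eval x.length) {r | accF B t Qg q (boolPair x r) = adBits Qg A x (q.eval x.length)} := by
  -- amplification of the padded language
  have hA' : (fstF ⁻¹' A : Language Bool) ∈ BPP := preimage_mem_BPP hA fstF_mem_FP
  obtain ⟨B, hB, t, ht⟩ := BPP_subset_bpErr_two_pow 1 hA'
  -- a bound on the queries
  obtain ⟨s, hs⟩ := exists_poly_length_le_of_mem_FP hQ
  refine ⟨B, hB, t, t.comp (2 * s.comp (2 * X + 2 + q) + 3), fun x => ?_⟩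
  set c := s.eval (2 * x.length + 2 + q.eval x.length) with hc
  have hlen : ∀ k < q.eval x.length, (Qg (boolPair x (adBits Qg A x k))).length ≤ c := by
    intro k hk
    refine (hs _).trans (TM2Iter.eval_mono s ?_)
    rw [length_boolPair, length_adBits]; omega
  have hT : (t.comp (2 * s.comp (2 * X + 2 + q) + 3)).eval x.length = t.eval (2 * c + 3) := by
    simp [hc]
  have hB' : ∀ w : List Bool, uniformProb (t.eval w.length) {y | ¬ (boolPair w y ∈ B ↔ fstF w ∈ A)} ≤ 1 / 2 ^ w.length := by
    intro w
    have h := ht w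
    simp only [pow_one] at h
    exact h
  have hbad := uniformProb_accF_ne_le (B := B) (t := t) (Qg := Qg) (q := q) hB' hlen (le_of_eq hT.symm)
  have hcompl : uniformProb (t.eval (2 * c + 3)) {r | accF B t Qg q (boolPair x r) = adBits Qg A x (q.eval x.length)} =
      1 - uniformProb (t.eval (2 * c + 3)) {r | accF B t Qg q (boolPair x r) ≠ adBits Qg A x (q.eval x.length)} := by
    rw [← uniformProb_compl]
    congr 1
    ext r
    simp
  rw [hT] at hbad
  rw [hT, hcompl]
  linarith

/-! ### Consequences: randomized algorithms -/

/-- Transport of an `FP` string function to the pair presentation of a `RandAlg` on strings. [folklore] -/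
theorem isPolyTime_of_FP {F : List Bool → List Bool} (hF : F ∈ FP) (T : Polynomial ℕ) {γ : Type} {eb : γ → List Bool}
    {run : List Bool → List Bool → γ} (hrun : ∀ x r, eb (run x r) = F (boolPair x r)) :
    (RandAlg.mk run (fun n => T.eval n)).IsPolyTime id eb := by
  refine ⟨?_, T, fun n => le_rfl⟩
  exact PolyTimeComputable.of_encode_eq (ea := id) (eb := id) (f := F)
    (fun p : List Bool × List Bool => boolPair p.1 p.2) (fun _ => rfl) (fun p => (hrun p.1 p.2).symm) hF

/-- **Pseudo-deterministic simulation of an adaptive reduction to a `BPP` language.** For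
`Qg, G ∈ FP`, a round polynomial `q` and `A ∈ BPP` there is a probabilistic polynomial-time
algorithm with an exactly polynomial coin budget that outputs the deterministic value
`adFn Qg q G A x` with probability `≥ 3/4` on every input `x`. [cite: AroraBarak2009, §7.4.1 with Thm. 7.10] -/
theorem exists_randAlg_adFn {A : Language Bool} (hA : A ∈ BPP) {Qg G : List Bool → List Bool} (hQ : Qg ∈ FP)
    (hG : G ∈ FP) (q : Polynomial ℕ) :
    ∃ R : RandAlg (List Bool) (List Bool), R.IsPolyTime id (id : List Bool → List Bool) ∧
      (∃ T : Polynomial ℕ, ∀ n, R.coinLen n = T.eval n) ∧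
        ∀ x : List Bool, 3 / 4 ≤ R.pr id x {adFn Qg q G A x} := by
  obtain ⟨B, hB, t, T, hgood⟩ := exists_accF_good hA hQ q
  set F : List Bool → List Bool := G ∘ fanoutFn fstF (accF B t Qg q) with hF
  have hFFP : F ∈ FP := comp_mem_FP hG (fanoutFn_mem_FP fstF_mem_FP (accF_mem_FP hQ hB))
  refine ⟨⟨fun x r => G (boolPair x (accF B t Qg q (boolPair x r))), fun n => T.eval n⟩,
    isPolyTime_of_FP hFFP T (fun x r => by simp [hF]), ⟨T, fun n => rfl⟩, fun x => ?_⟩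
  rw [RandAlg.pr_eq_uniformProb]
  refine (hgood x).trans (BPExp.uniformProb_mono_len fun r hr _ => ?_)
  simp only [Set.mem_setOf_eq] at hr
  simp [adFn_apply, hr]

/-- **The same on unary inputs**: a `RandAlg ℕ (List Bool)` reading `1ⁿ`, polynomial time w.r.t.
`unaryEncodeNat`, exactly polynomial coins, computing `adFn Qg q G A (1ⁿ)` with probability `≥ 3/4`
for every `n` — the format of `BPP`-refuters (`MetaComplexity/ConstructiveSeparations.lean`).
[cite: ChenEtAl2022, §5.1 (end of proof of Thm. 4)] -/
theorem exists_randAlg_adFn_unary {A : Language Bool} (hA : A ∈ BPP) {Qg G : List Bool → List Bool} (hQ : Qg ∈ FP)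
    (hG : G ∈ FP) (q : Polynomial ℕ) :
    ∃ R : RandAlg ℕ (List Bool), R.IsPolyTime unaryEncodeNat (id : List Bool → List Bool) ∧
      (∃ T : Polynomial ℕ, ∀ n, R.coinLen n = T.eval n) ∧
        ∀ n : ℕ, 3 / 4 ≤ R.pr unaryEncodeNat n {adFn Qg q G A (unaryEncodeNat n)} := by
  obtain ⟨R, ⟨hR, -⟩, ⟨T, hT⟩, hpr⟩ := exists_randAlg_adFn hA hQ hG q
  refine ⟨⟨fun n r => R.run (unaryEncodeNat n) r, R.coinLen⟩, ⟨?_, T, fun n => (hT n).le⟩, ⟨T, hT⟩, fun n => ?_⟩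
  · exact PolyTimeComputable.of_encode_eq (f := Function.uncurry R.run)
      (fun p : ℕ × List Bool => (unaryEncodeNat p.1, p.2)) (fun _ => rfl) (fun _ => rfl) hR
  · have h := hpr (unaryEncodeNat n)
    rw [RandAlg.pr_eq_uniformProb] at h ⊢
    exact h

/-- **`P^{BPP} = BPP` for bounded adaptive reductions**: `adLang Qg q D A ∈ BPP` whenever
`Qg ∈ FP`, `D ∈ P` and `A ∈ BPP`. [cite: AroraBarak2009, §7.4.1 with Thm. 7.10] -/
theorem adLang_mem_BPP {A : Language Bool} (hA : A ∈ BPP) {Qg : List Bool → List Bool} (hQ : Qg ∈ FP)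
    (q : Polynomial ℕ) {D : Language Bool} (hD : D ∈ Classes.P) : adLang Qg q D A ∈ BPP := by
  obtain ⟨B, hB, t, T, hgood⟩ := exists_accF_good hA hQ q
  set F : List Bool → List Bool := (fun w => encodeBool (D.boolIndicator w)) ∘ fanoutFn fstF (accF B t Qg q) with hF
  have hFFP : F ∈ FP := comp_mem_FP (indicatorFn_mem_FP hD) (fanoutFn_mem_FP fstF_mem_FP (accF_mem_FP hQ hB))
  refine mem_BPP_iff_randAlg_holds.2
    ⟨⟨fun x r => D.boolIndicator (boolPair x (accF B t Qg q (boolPair x r))), fun n => T.eval n⟩,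
      isPolyTime_of_FP hFFP T (fun x r => by simp [hF]), ⟨T, fun n => rfl⟩, fun x => ?_⟩
  rw [RandAlg.pr_eq_uniformProb]
  refine le_trans (by norm_num) ((hgood x).trans (BPExp.uniformProb_mono_len fun r hr _ => ?_))
  simp only [Set.mem_setOf_eq] at hr
  simp only [Set.mem_setOf_eq, hr, Set.mem_singleton_iff]
  exact boolIndicator_congr' mem_adLang_iff.symm

end AdBPPSim

end Literature.Computability.Complexity

end
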